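import Summits.Schanuel.Schanuel.Theses.RigidCore
import Literature.NumberTheory.Transcendental.ExpPointsExamples
import Mathlib.NumberTheory.Real.GoldenRatio
import Mathlib.Analysis.SpecialFunctions.Complex.Analytic
import Mathlib.Analysis.SpecialFunctions.Pow.Deriv
import Mathlib.Analysis.Analytic.IsolatedZeros

/-!
# drefute `cusp-germ-schneider-sparsity` — the Pell tightness witness (refuter, crux stmt-Schanuel-0971)

Kernel-checked form of the docstring claims "Tight: Pell conics (`g` ALGEBRAIC) carry `≍ log X` integer
points" (stub S) and "`√N`-type / irrational jets are NOT covered by Runge" (stub R):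

* `pellGerm σ = (√(5 + 4σ²) − √5)/(2σ)` (`pellGerm 0 = 0`), an ALGEBRAIC germ analytic at `0`
  (`(σ·g + √5/2)² = 5/4 + σ²`), built as `dslope` of `σ ↦ (5+4σ²)^{1/2} − √5`;
* `pellGerm_inv_fib`: `pellGerm (1/F_{2n}) = ψ^{2n}` (`ψ = (1−√5)/2`), hence
  `φ·F_{2n} + pellGerm (1/F_{2n}) = F_{2n+1} ∈ ℤ` for every `n ≥ 1` (Binet);
* `rationalJetRunge_false_with_real_jet`: stub (R) with its RATIONAL jet `q ∈ ℚ[X]` relaxed to a REAL jet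
  `A ∈ ℝ[X]` is FALSE — witness `e = 1`, `A = φ·X`, `g = pellGerm`: infinitely many integer points
  (`N = F_{2n}`) although `g` is not eventually `0`. So rationality of the jet is exactly what Runge consumes,
  and the real, non-rational jets are correctly handed on to (S)/(★); the same pair `(φX, pellGerm)` is the
  sharp end of S's transcendence hypothesis (an algebraic tail with an infinite, geometric — so
  positive-log-density — integer-point set).
Sorry-free; standard axioms.
-/

namespace RefuterDrefute.CuspGermSchneiderSparsity

open Filter Topology Complex Polynomial Real
open scoped goldenRatio

noncomputable section

/-- Auxiliary: `σ ↦ (5 + 4σ²)^{1/2} − √5` (principal branch; `5 + 4σ² ∈ slitPlane` near `0`). -/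
def pellAux : ℂ → ℂ := fun σ => ((5 : ℂ) + 4 * σ ^ 2) ^ ((2 : ℂ)⁻¹) - ((Real.sqrt 5 : ℝ) : ℂ)

/-- The Pell (golden-ratio) germ `g(σ) = (√(5+4σ²) − √5)/(2σ)`, extended by `g 0 = 0`. -/
def pellGerm : ℂ → ℂ := fun σ => dslope pellAux 0 σ / 2

theorem analyticAt_pellAux : AnalyticAt ℂ pellAux 0 := by
  have h1 : AnalyticAt ℂ (fun σ : ℂ => (5 : ℂ) + 4 * σ ^ 2) 0 :=
    analyticAt_const.add (analyticAt_const.mul (analyticAt_id.pow 2))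
  have h2 : AnalyticAt ℂ (fun σ : ℂ => ((5 : ℂ) + 4 * σ ^ 2) ^ ((2 : ℂ)⁻¹)) 0 := by
    refine h1.cpow analyticAt_const ?_
    have : (5 : ℂ) + 4 * (0 : ℂ) ^ 2 = ((5 : ℝ) : ℂ) := by push_cast; ring
    simp only [this, Complex.ofReal_mem_slitPlane]
    norm_num
  exact h2.sub analyticAt_const

theorem pellAux_zero : pellAux 0 = 0 := by
  have h5 : (5 : ℂ) + 4 * (0 : ℂ) ^ 2 = ((5 : ℝ) : ℂ) := by push_cast; ring
  have h2 : ((2 : ℂ)⁻¹) = (((2 : ℝ)⁻¹ : ℝ) : ℂ) := by push_cast; ring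
  simp only [pellAux, h5, h2, ← Complex.ofReal_cpow (by norm_num : (0 : ℝ) ≤ 5)]
  rw [← one_div, ← Real.sqrt_eq_rpow]
  simp

theorem hasDerivAt_pellAux_zero : HasDerivAt pellAux 0 0 := by
  have h1 : HasDerivAt (fun σ : ℂ => (5 : ℂ) + 4 * σ ^ 2) (4 * ((2 : ℕ) * (0 : ℂ) ^ (2 - 1))) 0 :=
    ((hasDerivAt_pow 2 (0 : ℂ)).const_mul 4).const_add 5
  have hmem : (fun σ : ℂ => (5 : ℂ) + 4 * σ ^ 2) 0 ∈ slitPlane := by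
    have : (5 : ℂ) + 4 * (0 : ℂ) ^ 2 = ((5 : ℝ) : ℂ) := by push_cast; ring
    simp only [this, Complex.ofReal_mem_slitPlane]
    norm_num
  have h2 := (h1.cpow_const (c := (2 : ℂ)⁻¹) hmem).sub_const (((Real.sqrt 5 : ℝ) : ℂ))
  simp only [Nat.cast_ofNat, pow_one, mul_zero, Nat.add_one_sub_one] at h2
  exact h2

theorem pellGerm_zero : pellGerm 0 = 0 := by
  simp [pellGerm, dslope_same, hasDerivAt_pellAux_zero.deriv]

theorem analyticAt_pellGerm : AnalyticAt ℂ pellGerm 0 := by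
  obtain ⟨p, hp⟩ := analyticAt_pellAux
  have h : AnalyticAt ℂ (dslope pellAux 0) 0 := ⟨_, hp.has_fpower_series_dslope_fslope⟩
  exact h.div analyticAt_const two_ne_zero

/-- On a positive real abscissa the auxiliary function is the real square root. -/
theorem pellAux_ofReal {s : ℝ} : pellAux (s : ℂ) = ((Real.sqrt (5 + 4 * s ^ 2) - Real.sqrt 5 : ℝ) : ℂ) := by
  have hnn : (0 : ℝ) ≤ 5 + 4 * s ^ 2 := by positivity
  have h5 : (5 : ℂ) + 4 * (s : ℂ) ^ 2 = ((5 + 4 * s ^ 2 : ℝ) : ℂ) := by push_cast; ring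
  have h2 : ((2 : ℂ)⁻¹) = (((2 : ℝ)⁻¹ : ℝ) : ℂ) := by push_cast; ring
  simp only [pellAux, h5, h2, ← Complex.ofReal_cpow hnn]
  rw [← one_div, ← Real.sqrt_eq_rpow]
  push_cast
  ring

/-- The Pell identity behind the germ: `√(5 + 4/F_{2n}²) = 2ψ^{2n}/F_{2n} + √5`. -/
theorem sqrt_pell_identity (n : ℕ) (hn : 1 ≤ n) :
    Real.sqrt (5 + 4 * ((Nat.fib (2 * n) : ℝ)⁻¹) ^ 2) =
      2 * (Nat.fib (2 * n) : ℝ)⁻¹ * ψ ^ (2 * n) + Real.sqrt 5 := by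
  set F : ℝ := (Nat.fib (2 * n) : ℝ) with hFdef
  set P : ℝ := φ ^ (2 * n) with hPdef
  set Q : ℝ := ψ ^ (2 * n) with hQdef
  have hFpos : 0 < F := by
    rw [hFdef]; exact_mod_cast Nat.fib_pos.mpr (by omega)
  have hQnn : 0 ≤ Q := by rw [hQdef, pow_mul]; positivity
  have hPQ : P * Q = 1 := by
    rw [hPdef, hQdef, ← mul_pow, goldenRatio_mul_goldenConj, pow_mul]; norm_num
  have h5 : Real.sqrt 5 * Real.sqrt 5 = 5 := Real.mul_self_sqrt (by norm_num)
  have hF : Real.sqrt 5 * F = P - Q := by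
    rw [hFdef, Real.coe_fib_eq, hPdef, hQdef]
    field_simp
  have hσ : F⁻¹ * F = 1 := inv_mul_cancel₀ hFpos.ne'
  set s : ℝ := F⁻¹ with hsdef
  have hy : 0 ≤ 2 * s * Q + Real.sqrt 5 := by positivity
  rw [Real.sqrt_eq_iff_mul_self_eq (by positivity) hy]
  linear_combination (-1 : ℝ) * h5 + (4 * Real.sqrt 5 * s * Q) * hσ + (-(4 * s ^ 2 * Q)) * hF +
    (-(4 * s ^ 2)) * hPQ

/-- Value of the Pell germ at `1/F_{2n}`: `pellGerm (1/F_{2n}) = ψ^{2n}`. -/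
theorem pellGerm_inv_fib (n : ℕ) (hn : 1 ≤ n) :
    pellGerm ((Nat.fib (2 * n) : ℂ))⁻¹ = ((ψ ^ (2 * n) : ℝ) : ℂ) := by
  have hFpos : (0 : ℝ) < Nat.fib (2 * n) := by exact_mod_cast Nat.fib_pos.mpr (by omega)
  have hcast : ((Nat.fib (2 * n) : ℂ))⁻¹ = (((Nat.fib (2 * n) : ℝ)⁻¹ : ℝ) : ℂ) := by push_cast; rfl
  have hne : (((Nat.fib (2 * n) : ℝ)⁻¹ : ℝ) : ℂ) ≠ 0 := by
    exact_mod_cast (inv_pos.mpr hFpos).ne'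
  rw [hcast]
  simp only [pellGerm, dslope_of_ne _ hne, slope_def_field, pellAux_zero, sub_zero, pellAux_ofReal,
    sqrt_pell_identity n hn]
  have hne' : ((Nat.fib (2 * n) : ℝ)⁻¹ : ℝ) ≠ 0 := (inv_pos.mpr hFpos).ne'
  push_cast
  field_simp
  ring

/-- (R) with the RATIONAL jet `q ∈ ℚ[X]` relaxed to a REAL polynomial jet `A ∈ ℝ[X]`. -/
def RationalJetRungeRealJet : Prop :=
  ∀ (e : ℕ), 0 < e → ∀ (A : Polynomial ℝ) (g : ℂ → ℂ), AnalyticAt ℂ g 0 → g 0 = 0 →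
    Set.Infinite {N : ℕ | ∃ L : ℤ,
      (A.map (algebraMap ℝ ℂ)).eval (N : ℂ) + g ((((N : ℝ) ^ ((e : ℝ)⁻¹) : ℝ) : ℂ))⁻¹ = L} →
    ∀ᶠ z in 𝓝 (0 : ℂ), g z = 0

/-- **Rationality of the jet is load-bearing in (R)** — the Pell witness: `e = 1`, `A = φ·X`, `g = pellGerm`.
Every even-indexed Fibonacci number is an integer point (`φF_{2n} + ψ^{2n} = F_{2n+1}`), yet `pellGerm` takes the
non-zero value `ψ^{2n}` at `1/F_{2n} → 0`, so it is not eventually `0`. -/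
theorem rationalJetRunge_false_with_real_jet : ¬ RationalJetRungeRealJet := by
  intro h
  have key := h 1 one_pos (Polynomial.C φ * Polynomial.X) pellGerm analyticAt_pellGerm pellGerm_zero ?_
  · -- `pellGerm` is not eventually zero at `0`
    obtain ⟨r, hr, hball⟩ := Metric.eventually_nhds_iff.mp key
    set M : ℕ := ⌈r⁻¹⌉₊ with hMdef
    have hM : r⁻¹ ≤ (M : ℝ) := Nat.le_ceil _
    have hfib : 2 * M ≤ Nat.fib (2 * M + 2) := Nat.fib_add_two_strictMono.id_le (2 * M)
    have hn : 1 ≤ M + 1 := by omega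
    have h2n : 2 * (M + 1) = 2 * M + 2 := by ring
    have hFpos : (0 : ℝ) < Nat.fib (2 * (M + 1)) := by exact_mod_cast Nat.fib_pos.mpr (by omega)
    have hbig : r⁻¹ < (Nat.fib (2 * (M + 1)) : ℝ) := by
      have h2 : 2 * M ≤ Nat.fib (2 * (M + 1)) := by rw [h2n]; exact hfib
      have h2' : (2 * M : ℝ) ≤ (Nat.fib (2 * (M + 1)) : ℝ) := by exact_mod_cast h2
      have hMpos : (0 : ℝ) < M := lt_of_lt_of_le (inv_pos.mpr hr) hM
      linarith
    have hdist : dist (((Nat.fib (2 * (M + 1)) : ℂ))⁻¹) 0 < r := by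
      rw [dist_zero_right, norm_inv, Complex.norm_natCast, inv_lt_comm₀ hFpos hr]
      exact hbig
    have hzero := hball hdist
    rw [pellGerm_inv_fib (M + 1) hn] at hzero
    have hψ : (ψ ^ (2 * (M + 1)) : ℝ) ≠ 0 := pow_ne_zero _ goldenConj_ne_zero
    exact hψ (by exact_mod_cast hzero)
  · -- the integer points contain every `F_{2n}`, `n ≥ 1`
    refine Set.infinite_of_forall_exists_gt fun M => ?_
    refine ⟨Nat.fib (2 * (M + 1)), ⟨(Nat.fib (2 * (M + 1) + 1) : ℤ), ?_⟩, ?_⟩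
    · have hval := pellGerm_inv_fib (M + 1) (by omega)
      have hbinet := Real.fib_succ_sub_goldenRatio_mul_fib (2 * (M + 1))
      have hbinetC := congrArg (fun x : ℝ => (x : ℂ)) hbinet
      push_cast at hbinetC
      simp only [Polynomial.map_mul, Polynomial.map_C, Polynomial.map_X, Polynomial.eval_mul,
        Polynomial.eval_C, Polynomial.eval_X, Complex.coe_algebraMap, Nat.cast_one, inv_one,
        Real.rpow_one, Complex.ofReal_natCast]
      rw [hval]
      push_cast
      linear_combination (-1 : ℂ) * hbinetC
    · have hfib : 2 * M ≤ Nat.fib (2 * M + 2) := Nat.fib_add_two_strictMono.id_le (2 * M)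
      have h2n : 2 * (M + 1) = 2 * M + 2 := by ring
      rw [h2n]
      rcases Nat.eq_zero_or_pos M with rfl | hM
      · exact Nat.fib_pos.mpr (by norm_num)
      · omega

end

end RefuterDrefute.CuspGermSchneiderSparsity
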